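import Literature.Geometry.Lorentzian.HypersurfaceRestriction
import Literature.Geometry.Lorentzian.SecondFundamentalFormApply
import HarnessLib

/-!
# Locality of the second fundamental form in the pair (map, normal field)

Support file (all results proved; no definitions, no named facts), a companion of
`HypersurfaceRestriction.lean`. The tree's second fundamental form
`PseudoRiemannianMetric.secondFundamentalForm I' f ν y` of a map `f : N → M` with a field `ν` along
it is computed from the covariant derivative of `t ↦ ν (c t)` along `f ∘ c`, `c` the chart-straight
curve through `y`, and from `df_y`; both only see the GERM at `y` of the lift
`z ↦ (f z, ν z) ∈ TM`. Hence (`covariantDerivAlong_congr_of_eventuallyEq` of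
`HypersurfaceRestriction.lean`, `Filter.EventuallyEq.mfderiv_eq`):

* `normalDerivAlong_congr_of_eventuallyEq` — `D_v ν₁ = D_v ν₂` at an interior point `y` if the
  lifts of `(f₁, ν₁)` and `(f₂, ν₂)` agree near `y`;
* `secondFundamentalForm_congr_of_eventuallyEq` — `K_{ν₁}(f₁) = K_{ν₂}(f₂)` at `y` under the same
  hypothesis (a cross-base-point equation: both forms live on `T_y N`).

Used to compute the second fundamental form of a leaf that is only LOCALLY a composite of charts
(the Boyer–Lindquist leaf of Kerr through the ingoing Kerr chart, off the axis).

References: B. O'Neill, *Semi-Riemannian Geometry* (1983), Ch. 3, Prop. 3.18; Ch. 4, pp. 98–99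
and Lemma 4.4 ff. (the induced connection and the shape tensor are local objects).
-/

noncomputable section

open Bundle Set Filter Function
open scoped Manifold ContDiff Topology

namespace Literature.Geometry.Lorentzian

namespace PseudoRiemannianMetric

variable {E : Type*} [NormedAddCommGroup E] [NormedSpace ℝ E] {H : Type*} [TopologicalSpace H]
  {I : ModelWithCorners ℝ E H} {M : Type*} [TopologicalSpace M] [ChartedSpace H M]
  {E' : Type*} [NormedAddCommGroup E'] [NormedSpace ℝ E'] {H' : Type*} [TopologicalSpace H']
  {I' : ModelWithCorners ℝ E' H'} {N : Type*} [TopologicalSpace N] [ChartedSpace H' N]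
  [IsManifold I ∞ M] [IsManifold I' ∞ N] {n : ℕ∞ω}
  {g : PseudoRiemannianMetric I n E (TangentSpace I : M → Type _)}
  [FiniteDimensional ℝ E] [g.HasLeviCivita]

variable (g) in
/-- **Locality of `D_v ν` in the pair `(f, ν)`**: at an interior point `y`, if the lifts
`z ↦ (f₁ z, ν₁ z)` and `z ↦ (f₂ z, ν₂ z)` into `TM` agree near `y`, then `D_v ν₁ = D_v ν₂` for every
`v ∈ T_y N` (the chart-straight curve through `y` is continuous at `0`, and `covariantDerivAlong`
only depends on the germ of the lifted curve). O'Neill 1983, Ch. 3, Prop. 3.18; Ch. 4, pp. 98–99.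
[cite: ONeill1983, Ch. 4, pp. 98–99] -/
theorem normalDerivAlong_congr_of_eventuallyEq {f₁ f₂ : N → M} {ν₁ : NormalField I f₁}
    {ν₂ : NormalField I f₂} {y : N} (hy : I'.IsInteriorPoint y)
    (h : (fun z ↦ (TotalSpace.mk' E (f₁ z) (ν₁ z) : TangentBundle I M)) =ᶠ[𝓝 y]
      fun z ↦ (TotalSpace.mk' E (f₂ z) (ν₂ z) : TangentBundle I M))
    (v : TangentSpace I' y) :
    g.normalDerivAlong f₁ ν₁ y v = g.normalDerivAlong f₂ ν₂ y v := by
  haveI : IsManifold I' 1 N := IsManifold.of_le (n := ∞) (by simp)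
  have h0 : curveThrough I' y v 0 = y := curveThrough_zero I' y v
  have hct : ContinuousAt (curveThrough I' y v) 0 :=
    (mdifferentiableAt_curveThrough_zero hy v).continuousAt
  have hc : Tendsto (curveThrough I' y v) (𝓝 0) (𝓝 y) := by
    rw [ContinuousAt, h0] at hct
    exact hct
  unfold normalDerivAlong
  apply covariantDerivAlong_congr_of_eventuallyEq
  filter_upwards [hc.eventually h] with t ht
  exact ht

variable [FiniteDimensional ℝ E']

variable (g) in
/-- **Locality of the second fundamental form in the pair `(f, ν)`**: at an interior point `y`,
if the lifts of `(f₁, ν₁)` and `(f₂, ν₂)` into `TM` agree near `y`, then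
`K_{ν₁}(f₁)(v, w) = K_{ν₂}(f₂)(v, w)` on `T_y N` (`normalDerivAlong_congr_of_eventuallyEq`,
`f₁ y = f₂ y` and `d(f₁)_y = d(f₂)_y`). O'Neill 1983, Ch. 4, Lemma 4.4 ff.
[cite: ONeill1983, Ch. 4, Lemma 4.4 ff.] -/
theorem secondFundamentalForm_congr_of_eventuallyEq {f₁ f₂ : N → M} {ν₁ : NormalField I f₁}
    {ν₂ : NormalField I f₂} {y : N} (hy : I'.IsInteriorPoint y)
    (h : (fun z ↦ (TotalSpace.mk' E (f₁ z) (ν₁ z) : TangentBundle I M)) =ᶠ[𝓝 y]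
      fun z ↦ (TotalSpace.mk' E (f₂ z) (ν₂ z) : TangentBundle I M)) :
    g.secondFundamentalForm I' f₁ ν₁ y = g.secondFundamentalForm I' f₂ ν₂ y := by
  haveI : FiniteDimensional ℝ (TangentSpace I' y) := inferInstanceAs (FiniteDimensional ℝ E')
  have hf : f₁ =ᶠ[𝓝 y] f₂ := h.mono fun z hz ↦ congrArg TotalSpace.proj hz
  have hpt : f₁ y = f₂ y := hf.self_of_nhds
  have hm : mfderiv I' I f₁ y = mfderiv I' I f₂ y := hf.mfderiv_eq
  have key : ∀ (p q : M), p = q → ∀ (D X : E), g.val p D X = g.val q D X := by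
    intro p q hpq D X
    subst hpq
    rfl
  refine (Module.finBasis ℝ (TangentSpace I' y)).ext fun i ↦ LinearMap.ext fun w ↦ ?_
  rw [secondFundamentalForm_apply_basis, secondFundamentalForm_apply_basis,
    g.normalDerivAlong_congr_of_eventuallyEq hy h, hm]
  exact key _ _ hpt _ _

end PseudoRiemannianMetric

end Literature.Geometry.Lorentzian

end
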